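import Summits.BirchSwinnertonDyer.BirchSwinnertonDyer.Theorems.EisensteinDepletionAtTwoStarDepletionModTwo
import HarnessLib

/-!
# Route `EisensteinDepletionAtTwo`, crux E1M `DepletedLambdaLawAtTwoMod` (item stmt-BirchSwinnertonDyer-20341), line `star`
# (lead `bsd-rank2-star-p1`) — the registered research stub (★_S) `StarCongruenceAtTwo` ⟺ its PRIMITIVE (`S`-free) form,
# and (★_S) ⟹ the lead's (★-core)

Cell `bsd-rank2` (run/shared/lean/pub/bsd-rank2/), seat `bsd-rank2-eng-2` GEN 7. THEOREMS ONLY — no definition, no named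
fact; route-independent. HONEST FRAMING: `Λ`-bookkeeping consequences of `depleted_red_identity_iff_primitive`
(`EisensteinDepletionAtTwoStarDepletionModTwo.lean`); nothing here proves (★_S) / (★-core), the ONE research stub of the line,
or bounds `λ(L₂(E))`; BSD is not proved by any of this. PARTITION (D-0054): none — r_an ≥ 2 axis S0, door T-r3₂.

* `starCongruenceAtTwo_of_primitive` / `primitive_of_starCongruenceAtTwo`: (★_S) (the skeleton's `StarCongruenceAtTwo`,
  local abbreviations unfolded, EVERY admissible `S`) ⟺ (★_N) `T²·red(u(L₀)) = red((1+T)^e)·red(u(G₀))·red(u(G₀^ι))·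
  ∏_{ℓ∣N_E, ℓ≠2} red(γ_ℓ−1)^{ord_ℓ N_E}` — the output shape of planner p2's (★-Eis) `StarEisTransformGen`;
* `starCore_of_starCongruenceAtTwo`: (★_S) ⟹ the LEAD's (★-core) (product over all prime factors of `N_E`, exponent `m_ℓ = 1`
  if `ord_ℓ N_E = 1` else `2`; skeleton v1.3 `stub_starCore`) — the converse of the lead's `starCongruence_of_starCore`
  (p546614): re-registering (★) as (★-core) neither weakens nor strengthens the line (on the habitat `2 ∤ N_E` and
  `1 ≤ ord_ℓ N_E ≤ 2` at `ℓ ∣ N_E`, p542009, so `m_ℓ = ord_ℓ N_E`).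

References: R. Greenberg, V. Vatsal, Invent. Math. 142 (2000) §3 Thm. (3.12), display (28) [GreenbergVatsal2000]; J. Silverman,
*Advanced Topics*, IV.10.2 [SilvermanATAEC1994].
-/


set_option linter.dupNamespace false
set_option autoImplicit false

noncomputable section

open scoped Classical

open Polynomial NumberField IsDedekindDomain WeierstrassCurve Rat.HeightOneSpectrum
  Literature.NumberTheory.EllipticCurves Literature.NumberTheory.EllipticCurves.GreenbergVatsal2000
  Literature.NumberTheory.EllipticCurves.Greenberg1999
  Summit.BirchSwinnertonDyer.Rank1Residual.X1 Summit.BirchSwinnertonDyer.Rank1Residual.X1.MuLambda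
  Summit.BirchSwinnertonDyer.Rank1Residual.X2.EulerFactorInvariants
  Summit.BirchSwinnertonDyer.BirchSwinnertonDyer.Theorems.TwoAdicTwistConverse

namespace Summit.BirchSwinnertonDyer.BirchSwinnertonDyer.Theorems.DepletionAtTwo

/-! ## §1. The registered stub (★_S) `StarCongruenceAtTwo` against its primitive form (★_N), as full statements -/

/-- **(★_N) ⟹ (★_S)**: the PRIMITIVE mod-2 Eisenstein identity on the type-A/B habitat —
`T²·red(u(L₀)) = red((1+T)^e)·red(u(G₀))·red(u(G₀^ι))·∏_{ℓ∣N_E, ℓ≠2} red(γ_ℓ − 1)^{ord_ℓ N_E}` — implies the line's registered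
stub `StarCongruenceAtTwo` (unfolded over tree names) for every admissible `S`. [cite: GreenbergVatsal2000, §3 Thm. (3.12), display (28)] -/
theorem starCongruenceAtTwo_of_primitive
    (hN : ∀ (W : WeierstrassCurve ℚ) [W.IsElliptic] [W.IsGloballyMinimal] (x : ℚ), IsOrdinaryAt W 2 →
      HasUniqueRationalTwoTorsionX W x →
      ((TwoTorsionRamifiedAtTwo x ∧ ¬ TwoTorsionOdd W x) ∨ (TwoTorsionOdd W x ∧ ¬ TwoTorsionRamifiedAtTwo x)) →
      ∀ ⦃N : ℕ⦄ [NeZero N] (f : CuspForm (CongruenceSubgroup.Gamma0 N) 2), ModularForms.IsNewformOf W f →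
      ∀ (c : ℚ) (L₀ : IwasawaAlgebra 2), L₀ ≠ 0 →
        iwasawaToPowerSeries 2 L₀ = PowerSeries.C (c : ℚ_[2]) * padicLFunction f (unitRoot W 2 : ℚ_[2]) →
      ∀ (cg : ℚ_[2]) (G₀ : IwasawaAlgebra 2), G₀ ≠ 0 →
        iwasawaToPowerSeries 2 G₀ = PowerSeries.C cg * klTwoNumerator →
      ∀ (ci : ℚ_[2]) (GI₀ : IwasawaAlgebra 2), GI₀ ≠ 0 →
        iwasawaToPowerSeries 2 GI₀ = PowerSeries.C ci * klTwoNumeratorInv →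
        ∃ e : ℤ_[2],
          PowerSeries.X ^ 2 * MuLambda.red (MuLambda.pfree L₀) =
            MuLambda.red (PowerSeries.binomialSeries ℤ_[2] e) * MuLambda.red (MuLambda.pfree G₀) *
              MuLambda.red (MuLambda.pfree GI₀) *
                ∏ ℓ ∈ (W.conductorNorm ℤ).primeFactors.filter (· ≠ 2),
                  MuLambda.red (GreenbergVatsal2000.frobeniusSeries 2 ℓ - 1) ^ (W.conductorNorm ℤ).factorization ℓ) :
    ∀ (W : WeierstrassCurve ℚ) [W.IsElliptic] [W.IsGloballyMinimal] (x : ℚ), IsOrdinaryAt W 2 →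
      HasUniqueRationalTwoTorsionX W x →
      ((TwoTorsionRamifiedAtTwo x ∧ ¬ TwoTorsionOdd W x) ∨ (TwoTorsionOdd W x ∧ ¬ TwoTorsionRamifiedAtTwo x)) →
      ∀ ⦃N : ℕ⦄ [NeZero N] (f : CuspForm (CongruenceSubgroup.Gamma0 N) 2), ModularForms.IsNewformOf W f →
      ∀ (c : ℚ) (L₀ : IwasawaAlgebra 2), L₀ ≠ 0 →
        iwasawaToPowerSeries 2 L₀ = PowerSeries.C (c : ℚ_[2]) * padicLFunction f (unitRoot W 2 : ℚ_[2]) →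
      ∀ (cg : ℚ_[2]) (G₀ : IwasawaAlgebra 2), G₀ ≠ 0 →
        iwasawaToPowerSeries 2 G₀ = PowerSeries.C cg * klTwoNumerator →
      ∀ (ci : ℚ_[2]) (GI₀ : IwasawaAlgebra 2), GI₀ ≠ 0 →
        iwasawaToPowerSeries 2 GI₀ = PowerSeries.C ci * klTwoNumeratorInv →
      ∀ (S : Finset ℕ), (∀ ℓ ∈ S, Nat.Prime ℓ) → (∀ ℓ : ℕ, Nat.Prime ℓ → ℓ ∣ W.conductorNorm ℤ → ℓ ∈ S) →
        ∃ e : ℤ_[2],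
          PowerSeries.X ^ 2 * MuLambda.red (MuLambda.pfree (L₀ * ∏ ℓ ∈ S,
              (if h : Nat.Prime ℓ ∧ ℓ ≠ 2 then
                GreenbergVatsal2000.eulerFactorElement W 2
                  ((Rat.HeightOneSpectrum.primesEquiv (R := NumberField.RingOfIntegers ℚ)).symm ⟨ℓ, h.1⟩)
              else 1))) =
            MuLambda.red (PowerSeries.binomialSeries ℤ_[2] e) * MuLambda.red (MuLambda.pfree G₀) *
              MuLambda.red (MuLambda.pfree GI₀) *
                ∏ ℓ ∈ S.filter (· ≠ 2), MuLambda.red (GreenbergVatsal2000.frobeniusSeries 2 ℓ - 1) ^ 2 := by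
  intro W _ _ x hord hx hAB N _ f hf c L₀ hL₀ hι cg G₀ hG₀ hιG ci GI₀ hGI₀ hιGI S hS hSN
  obtain ⟨e, he⟩ := hN W x hord hx hAB f hf c L₀ hL₀ hι cg G₀ hG₀ hιG ci GI₀ hGI₀ hιGI
  exact ⟨e, (depleted_red_identity_iff_primitive W hx.1 hL₀ _ S hS hSN).mpr he⟩

/-- **(★_S) ⟹ (★_N)**: conversely the registered stub (at `S` = the prime factors of `N_E`) gives the primitive identity.
[cite: GreenbergVatsal2000, §3 Thm. (3.12), display (28)] -/
theorem primitive_of_starCongruenceAtTwo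
    (hS : ∀ (W : WeierstrassCurve ℚ) [W.IsElliptic] [W.IsGloballyMinimal] (x : ℚ), IsOrdinaryAt W 2 →
      HasUniqueRationalTwoTorsionX W x →
      ((TwoTorsionRamifiedAtTwo x ∧ ¬ TwoTorsionOdd W x) ∨ (TwoTorsionOdd W x ∧ ¬ TwoTorsionRamifiedAtTwo x)) →
      ∀ ⦃N : ℕ⦄ [NeZero N] (f : CuspForm (CongruenceSubgroup.Gamma0 N) 2), ModularForms.IsNewformOf W f →
      ∀ (c : ℚ) (L₀ : IwasawaAlgebra 2), L₀ ≠ 0 →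
        iwasawaToPowerSeries 2 L₀ = PowerSeries.C (c : ℚ_[2]) * padicLFunction f (unitRoot W 2 : ℚ_[2]) →
      ∀ (cg : ℚ_[2]) (G₀ : IwasawaAlgebra 2), G₀ ≠ 0 →
        iwasawaToPowerSeries 2 G₀ = PowerSeries.C cg * klTwoNumerator →
      ∀ (ci : ℚ_[2]) (GI₀ : IwasawaAlgebra 2), GI₀ ≠ 0 →
        iwasawaToPowerSeries 2 GI₀ = PowerSeries.C ci * klTwoNumeratorInv →
      ∀ (S : Finset ℕ), (∀ ℓ ∈ S, Nat.Prime ℓ) → (∀ ℓ : ℕ, Nat.Prime ℓ → ℓ ∣ W.conductorNorm ℤ → ℓ ∈ S) →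
        ∃ e : ℤ_[2],
          PowerSeries.X ^ 2 * MuLambda.red (MuLambda.pfree (L₀ * ∏ ℓ ∈ S,
              (if h : Nat.Prime ℓ ∧ ℓ ≠ 2 then
                GreenbergVatsal2000.eulerFactorElement W 2
                  ((Rat.HeightOneSpectrum.primesEquiv (R := NumberField.RingOfIntegers ℚ)).symm ⟨ℓ, h.1⟩)
              else 1))) =
            MuLambda.red (PowerSeries.binomialSeries ℤ_[2] e) * MuLambda.red (MuLambda.pfree G₀) *
              MuLambda.red (MuLambda.pfree GI₀) *
                ∏ ℓ ∈ S.filter (· ≠ 2), MuLambda.red (GreenbergVatsal2000.frobeniusSeries 2 ℓ - 1) ^ 2) :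
    ∀ (W : WeierstrassCurve ℚ) [W.IsElliptic] [W.IsGloballyMinimal] (x : ℚ), IsOrdinaryAt W 2 →
      HasUniqueRationalTwoTorsionX W x →
      ((TwoTorsionRamifiedAtTwo x ∧ ¬ TwoTorsionOdd W x) ∨ (TwoTorsionOdd W x ∧ ¬ TwoTorsionRamifiedAtTwo x)) →
      ∀ ⦃N : ℕ⦄ [NeZero N] (f : CuspForm (CongruenceSubgroup.Gamma0 N) 2), ModularForms.IsNewformOf W f →
      ∀ (c : ℚ) (L₀ : IwasawaAlgebra 2), L₀ ≠ 0 →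
        iwasawaToPowerSeries 2 L₀ = PowerSeries.C (c : ℚ_[2]) * padicLFunction f (unitRoot W 2 : ℚ_[2]) →
      ∀ (cg : ℚ_[2]) (G₀ : IwasawaAlgebra 2), G₀ ≠ 0 →
        iwasawaToPowerSeries 2 G₀ = PowerSeries.C cg * klTwoNumerator →
      ∀ (ci : ℚ_[2]) (GI₀ : IwasawaAlgebra 2), GI₀ ≠ 0 →
        iwasawaToPowerSeries 2 GI₀ = PowerSeries.C ci * klTwoNumeratorInv →
        ∃ e : ℤ_[2],
          PowerSeries.X ^ 2 * MuLambda.red (MuLambda.pfree L₀) =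
            MuLambda.red (PowerSeries.binomialSeries ℤ_[2] e) * MuLambda.red (MuLambda.pfree G₀) *
              MuLambda.red (MuLambda.pfree GI₀) *
                ∏ ℓ ∈ (W.conductorNorm ℤ).primeFactors.filter (· ≠ 2),
                  MuLambda.red (GreenbergVatsal2000.frobeniusSeries 2 ℓ - 1) ^ (W.conductorNorm ℤ).factorization ℓ := by
  intro W _ _ x hord hx hAB N _ f hf c L₀ hL₀ hι cg G₀ hG₀ hιG ci GI₀ hGI₀ hιGI
  have hprimes : ∀ ℓ ∈ (W.conductorNorm ℤ).primeFactors, Nat.Prime ℓ := fun ℓ hℓ ↦ Nat.prime_of_mem_primeFactors hℓ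
  have hcont : ∀ ℓ : ℕ, Nat.Prime ℓ → ℓ ∣ W.conductorNorm ℤ → ℓ ∈ (W.conductorNorm ℤ).primeFactors := fun ℓ hp hd ↦
    (Nat.mem_primeFactors_of_ne_zero (conductorNorm_pos_holds W).ne').mpr ⟨hp, hd⟩
  obtain ⟨e, he⟩ := hS W x hord hx hAB f hf c L₀ hL₀ hι cg G₀ hG₀ hιG ci GI₀ hGI₀ hιGI _ hprimes hcont
  exact ⟨e, (depleted_red_identity_iff_primitive W hx.1 hL₀ _ _ hprimes hcont).mp he⟩


/-! ## §2. (★_S) ⟹ (★-core): the lead's reshaped research stub is EQUIVALENT to the registered one -/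

/-- **(★_S) ⟹ (★-core)** — the converse of the lead's `starCongruence_of_starCore` (p546614): the registered stub
`StarCongruenceAtTwo` implies its depletion-free core in the LEAD's convention (product over all prime factors of `N_E`,
exponent `m_ℓ = 1` if `ord_ℓ N_E = 1` else `2`). So re-registering (★) as (★-core) (skeleton v1.3 `stub_starCore`) neither
weakens nor strengthens the line's research content. (On the habitat `2 ∤ N_E` and `1 ≤ ord_ℓ N_E ≤ 2` at `ℓ ∣ N_E`, so
`m_ℓ = ord_ℓ N_E` and §6 applies.) [cite: GreenbergVatsal2000, §3 Thm. (3.12), display (28)] [cite: SilvermanATAEC1994, Thm. IV.10.2] -/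
theorem starCore_of_starCongruenceAtTwo
    (hS : ∀ (W : WeierstrassCurve ℚ) [W.IsElliptic] [W.IsGloballyMinimal] (x : ℚ), IsOrdinaryAt W 2 →
      HasUniqueRationalTwoTorsionX W x →
      ((TwoTorsionRamifiedAtTwo x ∧ ¬ TwoTorsionOdd W x) ∨ (TwoTorsionOdd W x ∧ ¬ TwoTorsionRamifiedAtTwo x)) →
      ∀ ⦃N : ℕ⦄ [NeZero N] (f : CuspForm (CongruenceSubgroup.Gamma0 N) 2), ModularForms.IsNewformOf W f →
      ∀ (c : ℚ) (L₀ : IwasawaAlgebra 2), L₀ ≠ 0 →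
        iwasawaToPowerSeries 2 L₀ = PowerSeries.C (c : ℚ_[2]) * padicLFunction f (unitRoot W 2 : ℚ_[2]) →
      ∀ (cg : ℚ_[2]) (G₀ : IwasawaAlgebra 2), G₀ ≠ 0 →
        iwasawaToPowerSeries 2 G₀ = PowerSeries.C cg * klTwoNumerator →
      ∀ (ci : ℚ_[2]) (GI₀ : IwasawaAlgebra 2), GI₀ ≠ 0 →
        iwasawaToPowerSeries 2 GI₀ = PowerSeries.C ci * klTwoNumeratorInv →
      ∀ (S : Finset ℕ), (∀ ℓ ∈ S, Nat.Prime ℓ) → (∀ ℓ : ℕ, Nat.Prime ℓ → ℓ ∣ W.conductorNorm ℤ → ℓ ∈ S) →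
        ∃ e : ℤ_[2],
          PowerSeries.X ^ 2 * MuLambda.red (MuLambda.pfree (L₀ * ∏ ℓ ∈ S,
              (if h : Nat.Prime ℓ ∧ ℓ ≠ 2 then
                GreenbergVatsal2000.eulerFactorElement W 2
                  ((Rat.HeightOneSpectrum.primesEquiv (R := NumberField.RingOfIntegers ℚ)).symm ⟨ℓ, h.1⟩)
              else 1))) =
            MuLambda.red (PowerSeries.binomialSeries ℤ_[2] e) * MuLambda.red (MuLambda.pfree G₀) *
              MuLambda.red (MuLambda.pfree GI₀) *
                ∏ ℓ ∈ S.filter (· ≠ 2), MuLambda.red (GreenbergVatsal2000.frobeniusSeries 2 ℓ - 1) ^ 2) :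
    ∀ (W : WeierstrassCurve ℚ) [W.IsElliptic] [W.IsGloballyMinimal] (x : ℚ), IsOrdinaryAt W 2 →
      HasUniqueRationalTwoTorsionX W x →
      ((TwoTorsionRamifiedAtTwo x ∧ ¬ TwoTorsionOdd W x) ∨ (TwoTorsionOdd W x ∧ ¬ TwoTorsionRamifiedAtTwo x)) →
      ∀ ⦃N : ℕ⦄ [NeZero N] (f : CuspForm (CongruenceSubgroup.Gamma0 N) 2), ModularForms.IsNewformOf W f →
      ∀ (c : ℚ) (L₀ : IwasawaAlgebra 2), L₀ ≠ 0 →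
        iwasawaToPowerSeries 2 L₀ = PowerSeries.C (c : ℚ_[2]) * padicLFunction f (unitRoot W 2 : ℚ_[2]) →
      ∀ (cg : ℚ_[2]) (G₀ : IwasawaAlgebra 2), G₀ ≠ 0 →
        iwasawaToPowerSeries 2 G₀ = PowerSeries.C cg * klTwoNumerator →
      ∀ (ci : ℚ_[2]) (GI₀ : IwasawaAlgebra 2), GI₀ ≠ 0 →
        iwasawaToPowerSeries 2 GI₀ = PowerSeries.C ci * klTwoNumeratorInv →
        ∃ e : ℤ_[2],
          PowerSeries.X ^ 2 * MuLambda.red (MuLambda.pfree L₀) =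
            MuLambda.red (PowerSeries.binomialSeries ℤ_[2] e) * MuLambda.red (MuLambda.pfree G₀) *
              MuLambda.red (MuLambda.pfree GI₀) *
                ∏ ℓ ∈ (W.conductorNorm ℤ).primeFactors, MuLambda.red (GreenbergVatsal2000.frobeniusSeries 2 ℓ - 1) ^
                  (if (W.conductorNorm ℤ).factorization ℓ = 1 then 1 else 2) := by
  intro W _ _ x hord hx hAB N _ f hf c L₀ hL₀ hι cg G₀ hG₀ hιG ci GI₀ hGI₀ hιGI
  obtain ⟨e, he⟩ := primitive_of_starCongruenceAtTwo hS W x hord hx hAB f hf c L₀ hL₀ hι cg G₀ hG₀ hιG ci GI₀ hGI₀ hιGI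
  refine ⟨e, ?_⟩
  have h2N : ¬ 2 ∣ W.conductorNorm ℤ := not_dvd_conductorNorm_of_hasGoodReductionAtPrime W hord.1
  have hfilter : (W.conductorNorm ℤ).primeFactors.filter (· ≠ 2) = (W.conductorNorm ℤ).primeFactors := by
    refine Finset.filter_true_of_mem fun ℓ hℓ h2 ↦ h2N ?_
    rw [← h2]
    exact Nat.dvd_of_mem_primeFactors hℓ
  rw [he, hfilter]
  congr 1
  refine Finset.prod_congr rfl fun ℓ hℓ ↦ ?_
  obtain ⟨hp, hdvd⟩ := (Nat.mem_primeFactors_of_ne_zero (conductorNorm_pos_holds W).ne').mp hℓ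
  haveI : Fact ℓ.Prime := ⟨hp⟩
  have hℓ2 : ℓ ≠ 2 := fun h ↦ h2N (h ▸ hdvd)
  have hle := factorization_conductorNorm_le_two_of_ne_two_of_hasRationalTwoTorsionX W ℓ hℓ2 hx.1
  have hpos : 0 < (W.conductorNorm ℤ).factorization ℓ := hp.factorization_pos_of_dvd (conductorNorm_pos_holds W).ne' hdvd
  by_cases h1 : (W.conductorNorm ℤ).factorization ℓ = 1
  · rw [if_pos h1, h1]
  · rw [if_neg h1]
    congr 1
    omega

end Summit.BirchSwinnertonDyer.BirchSwinnertonDyer.Theorems.DepletionAtTwo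

end
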